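/-
Copyright (c) 2026 the pub-hodgecm-mathlib formalisation cell (harness21).  Prover seat hodgecm-mathlib-K2Liu-p03 (g0), Track B ∕ K2-LIT
(build stream 29), hLiu418 #184♮ = `stmt-HodgeConjecture-24832`, unit U3b «DOUBLING», socket #12₀ — the payment of
`K2LiuCurveThetaSigsU3bDoubling.sig_K2LiuDoublingLagrangianIsGraph` TOKEN FOR TOKEN.  2026-09-03.
-/
import Mathlib.LinearAlgebra.FiniteDimensional.Lemmas   -- `LinearMap.linearEquivOfInjective(_apply)`
import Mathlib.LinearAlgebra.Prod                        -- `LinearMap.graph`, `LinearMap.mem_graph_iff`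
import Mathlib.LinearAlgebra.Dimension.Constructions     -- `Module.finrank_fin_fun`
import Mathlib.LinearAlgebra.Matrix.ToLin                -- `dotProduct`, `Matrix.mulVec`
import HarnessLib

/-!
# hLiu418 ∕ Track B «K2-LIT», unit U3b «DOUBLING», socket #12₀: EVERY LAGRANGIAN OF THE DOUBLED ANISOTROPIC SPACE `V ⊕ (−V)` IS THE GRAPH OF AN ISOMETRY OF `V`
# (payment of `Cruxes/HLiu418/Lines/K2_Liu_CurveThetaSigs_U3b_Doubling.lean :: sig_K2LiuDoublingLagrangianIsGraph`, statement bytes frozen)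

Cell `pub/hodgecm-mathlib` (D-0151), FLOOR 0, named input hLiu418 = `stmt-HodgeConjecture-24832` (★ `Liu2021.curveTheta_nonOrthogonal₂`), route of record
`HCCMUnconditional`; LEAD F0P6-plan «M-154j» line shape, planner K2Liu-plan (g0) socket module U3b (sha16 5260f162bae4f51f), EMIT «SKELETON LANDED K2Liu»
(REQUESTS l.72360) file #12₀ ↦ seat K2Liu-p03.  THEOREMS ONLY (no `def`, no `instance`, no `notation`, no named-fact hypothesis, no `sorry`); imports = Mathlib + HarnessLib;
lane `--supports stmt-HodgeConjecture-24832` (count-neutral: the file is one brick of the floored scaffold of «M-154i» §3∕§4, it does not move 24832).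

THE OBJECTS.  `L` a field with a ring endomorphism `c : L →+* L` (in the application: the CM conjugation of `E/F`), `V = L^n` (`Fin n → L`), `H ∈ M_n(L)` and the
`c`-sesquilinear form `B(x, y) = Σ_i c(x_i) (H y)_i = dotProduct (c ∘ x) (H *ᵥ y)`, assumed ANISOTROPIC: `B(x, x) ≠ 0` for `x ≠ 0`.  The doubled space of the
generalised doubling method [GelbartPiatetskishapiroRallis1987 §2; Liu2021 §B.3 p. 101 «V^◇ = V ⊕ (−V)», `V^± = {(v, ±v)}`] is `V × V` with the form `B ⊕ (−B)`; a subspace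
`U ≤ V × V` is TOTALLY ISOTROPIC for it iff `B(u₁, v₁) = B(u₂, v₂)` for all `u, v ∈ U`, and a LAGRANGIAN when moreover `dim U = n`.

THE MATHEMATICS (the `a = 0` orbit lemma of the doubling integral for an anisotropic `V`: no negligible orbits [Liu2021 (B.4) & Lem. B.11]).  Let `U` be a Lagrangian.
(§1) The first projection `π₁ : U → V` is injective: if `u = (0, u₂) ∈ U` then `B(u₂, u₂) = B(0, 0) = 0`, so `u₂ = 0` by anisotropy.  (§2) `dim U = n = dim V`, so `π₁|_U`
is a linear isomorphism `e : U ≃ V` (Mathlib `LinearMap.linearEquivOfInjective`); put `φ := π₂ ∘ e⁻¹ : V → V`.  Then `U = graph φ` (for `u ∈ U`, `e⁻¹ u₁ = u`, so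
`φ u₁ = u₂`; conversely `(x, φ x) = e⁻¹ x ∈ U`), and `φ` is an isometry of `B` because `(x, φ x), (y, φ y) ∈ U` and `U` is totally isotropic:
`B(φ x, φ y) = B(x, y)`.  Pure linear algebra over any field and any `c`; nothing printed is asserted.

* §1 `fst_comp_subtype_injective`        · `π₁|_U` is injective for a totally isotropic `U` when `B` is anisotropic;
* §2 **`DoublingLagrangianIsGraph`**     · `sig_K2LiuDoublingLagrangianIsGraph` TOKEN FOR TOKEN (home probe `example : type_of% @DoublingLagrangianIsGraph =
      type_of% @K2LiuCurveThetaSigsU3bDoubling.sig_K2LiuDoublingLagrangianIsGraph := rfl`, K2/K2Liu-p03/g0/Probe_K2LiuDoublingLagrangianIsGraph.lean).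

WHAT IS NOT HERE.  The Witt half (socket #12₁ `sig_K2LiuHermitianWittTransitive`, seat K2Liu-p04): transitivity of `U(J)(L)` on totally isotropic subspaces of
equal dimension; together the two sockets give `P(F) \ U(V^◇)(F) ≅ {Lagrangians}` = a single `U(V) × U(V)`-orbit at `a = 0` (consumers: files #12 `K2LiuDoublingOrbits`,
#13 `K2LiuDoublingUnfolding`, road S-B).

HONEST LABEL.  HC_CM is proved only modulo the 7 printed citations (2 remaining named inputs: hLiu418 = `stmt-HodgeConjecture-24832`, h413 = `stmt-HodgeConjecture-24833`)
until rung 0 closes.  Seat K2Liu-p03 (g0).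

## References
* [Liu2021] Y. Liu, *Fourier–Jacobi cycles and arithmetic relative trace formula*, Camb. J. Math. 9 (2021), App. B §B.3, (B.4) and Lemma B.11, pp. 101–102.
* [GelbartPiatetskishapiroRallis1987] S. Gelbart, I. Piatetski-Shapiro, S. Rallis, *Explicit constructions of automorphic L-functions*, LNM 1254 (1987), Part A (Piatetski-Shapiro–Rallis, *L-functions for the classical groups*) §2 (orbits of `P \ U(V^◇) / U(V) × U(V)`).
-/

set_option autoImplicit false
-- the mandated namespace repeats the single-problem summit's segment (`HodgeConjecture.HodgeConjecture`)
set_option linter.dupNamespace false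

namespace Summit.HodgeConjecture.HodgeConjecture.Cruxes.HLiu418.K2LiuDoublingLagrangianIsGraph

open scoped Matrix

section Injective

variable {L : Type} [Field L] (c : L →+* L) {n : ℕ} (H : Matrix (Fin n) (Fin n) L)

/-- §1 · **the first projection of a totally isotropic subspace of the doubled space is injective when the form is anisotropic**
[Liu2021 §B.3 p. 101; GelbartPiatetskishapiroRallis1987 §2].  For `U ≤ V × V` (`V = L^n`) with `B(u₁, v₁) = B(u₂, v₂)` for all `u, v ∈ U`
(total isotropy for `B ⊕ (−B)`) and `B` anisotropic (`B(x, x) ≠ 0` for `x ≠ 0`), the map `π₁|_U = fst ∘ U.subtype : U → V` is injective: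
`u = (0, u₂) ∈ U` forces `B(u₂, u₂) = B(0, 0) = 0`, hence `u₂ = 0`. [cite: Liu2021, App. B §B.3 (B.4) & Lem. B.11, pp. 101–102] -/
theorem fst_comp_subtype_injective
    (hH : ∀ x : Fin n → L, x ≠ 0 → dotProduct (fun i => c (x i)) (H.mulVec x) ≠ 0)
    (U : Submodule L ((Fin n → L) × (Fin n → L)))
    (hU : ∀ u ∈ U, ∀ v ∈ U,
      dotProduct (fun i => c (u.1 i)) (H.mulVec v.1) = dotProduct (fun i => c (u.2 i)) (H.mulVec v.2)) :
    Function.Injective ((LinearMap.fst L (Fin n → L) (Fin n → L)).comp U.subtype) := by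
  refine (injective_iff_map_eq_zero _).2 fun u hu => ?_
  -- `hu : (u : V × V).1 = 0`
  simp only [LinearMap.coe_comp, Function.comp_apply, Submodule.coe_subtype, LinearMap.fst_apply] at hu
  have h := hU (u : (Fin n → L) × (Fin n → L)) u.2 (u : (Fin n → L) × (Fin n → L)) u.2
  rw [hu, Matrix.mulVec_zero, dotProduct_zero] at h
  -- `h : 0 = B(u₂, u₂)`; anisotropy forces `u₂ = 0`
  have h2 : (u : (Fin n → L) × (Fin n → L)).2 = 0 := by
    by_contra hne
    exact hH _ hne h.symm
  exact Subtype.ext (Prod.ext hu h2)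

end Injective

/-- §2 · **socket #12₀ `sig_K2LiuDoublingLagrangianIsGraph` TOKEN FOR TOKEN — every Lagrangian of the doubled anisotropic space
`V ⊕ (−V)` is the graph of an isometry of `V`** [Liu2021 §B.3 (B.4) & Lem. B.11, pp. 101–102; GelbartPiatetskishapiroRallis1987 §2].
For a field `L`, a ring endomorphism `c`, `H ∈ M_n(L)` with `B(x, y) = Σ c(x_i) (H y)_i` anisotropic, and `U ≤ L^n × L^n` totally
isotropic for `B ⊕ (−B)` with `finrank U = n`: there is an `L`-linear `φ : L^n → L^n` preserving `B` with `U = LinearMap.graph φ`.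
Proof: `π₁|_U` is injective (§1) between spaces of equal finite dimension, hence a linear equivalence `e`
(`LinearMap.linearEquivOfInjective`); `φ := π₂ ∘ e.symm`; the graph identity is `LinearMap.mem_graph_iff`, the isometry is total
isotropy applied to `e.symm x, e.symm y ∈ U`. [cite: Liu2021, App. B §B.3 (B.4) & Lem. B.11, pp. 101–102] -/
theorem DoublingLagrangianIsGraph :
    ∀ (L : Type) [Field L] (c : L →+* L) (n : ℕ) (H : Matrix (Fin n) (Fin n) L),
      (∀ x : Fin n → L, x ≠ 0 → dotProduct (fun i => c (x i)) (H.mulVec x) ≠ 0) →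
        ∀ U : Submodule L ((Fin n → L) × (Fin n → L)),
          (∀ u ∈ U, ∀ v ∈ U,
              dotProduct (fun i => c (u.1 i)) (H.mulVec v.1) = dotProduct (fun i => c (u.2 i)) (H.mulVec v.2)) →
            Module.finrank L U = n →
              ∃ φ : (Fin n → L) →ₗ[L] (Fin n → L),
                (∀ x y : Fin n → L,
                    dotProduct (fun i => c (φ x i)) (H.mulVec (φ y)) = dotProduct (fun i => c (x i)) (H.mulVec y)) ∧
                  U = LinearMap.graph φ := by
  intro L _ c n H hH U hU hdim
  -- §1: the first projection restricted to `U` is injective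
  have hinj : Function.Injective ((LinearMap.fst L (Fin n → L) (Fin n → L)).comp U.subtype) :=
    fst_comp_subtype_injective c H hH U hU
  -- equal finite dimensions: `finrank U = n = finrank L^n`
  have hdim' : Module.finrank L U = Module.finrank L (Fin n → L) := by
    rw [hdim, Module.finrank_fin_fun]
  -- the induced linear equivalence `e : U ≃ V`, `e u = u₁`
  let e : U ≃ₗ[L] (Fin n → L) :=
    ((LinearMap.fst L (Fin n → L) (Fin n → L)).comp U.subtype).linearEquivOfInjective hinj hdim'
  have he : ∀ u : U, e u = (u : (Fin n → L) × (Fin n → L)).1 := fun u =>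
    LinearMap.linearEquivOfInjective_apply hinj hdim' u
  have he₁ : ∀ x : Fin n → L, ((e.symm x : U) : (Fin n → L) × (Fin n → L)).1 = x := fun x => by
    rw [← he, LinearEquiv.apply_symm_apply]
  -- `φ := π₂ ∘ e.symm`
  refine ⟨((LinearMap.snd L (Fin n → L) (Fin n → L)).comp U.subtype).comp e.symm.toLinearMap, fun x y => ?_, ?_⟩
  · -- isometry: total isotropy at `e.symm x, e.symm y ∈ U`, whose first components are `x, y`
    have h := hU _ (e.symm x).2 _ (e.symm y).2
    rw [he₁, he₁] at h
    simpa only [LinearMap.coe_comp, Function.comp_apply, LinearEquiv.coe_coe, Submodule.coe_subtype,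
      LinearMap.snd_apply] using h.symm
  · -- graph identity
    ext u
    rw [LinearMap.mem_graph_iff]
    simp only [LinearMap.coe_comp, Function.comp_apply, LinearEquiv.coe_coe, Submodule.coe_subtype,
      LinearMap.snd_apply]
    constructor
    · intro hu
      -- `e ⟨u, hu⟩ = u₁`, so `e.symm u₁ = ⟨u, hu⟩` and `φ u₁ = u₂`
      have hsymm : e.symm u.1 = ⟨u, hu⟩ := by
        rw [LinearEquiv.symm_apply_eq, he]
      rw [hsymm]
    · intro hu
      -- `u = (u₁, φ u₁) = ↑(e.symm u₁) ∈ U`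
      have hu' : u = ((e.symm u.1 : U) : (Fin n → L) × (Fin n → L)) := Prod.ext (he₁ u.1).symm hu
      rw [hu']
      exact (e.symm u.1).2

end Summit.HodgeConjecture.HodgeConjecture.Cruxes.HLiu418.K2LiuDoublingLagrangianIsGraph
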